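import Mathlib
import Literature.AlgebraicGeometry.Motives.TannakianDistributionsBaseChange
import HarnessLib

/-!
# The dual of a finite free module ∕ bialgebra commutes with base change: `(S ⊗_R A)^* = S ⊗_R A^*`
(Tate, *Finite flat group schemes* (in Cornell–Silverman–Stevens 1997), §(3.8) «The dual Hopf algebra and Cartier duality»,
p. 145: «for an `R`-algebra `B`, `(A_B)′ = A′_B := A′ ⊗_R B`» — formation of the dual commutes with base extension for `A`
finite and free (locally free) over `R`; Milne, *Algebraic Groups*, Ch. 10 §d 10.19 (the base-change map `μ ↦ μ_S` on
linear forms))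

Topic `RingTheory/HopfAlgebra`; namespace `Literature.RingTheory.HopfAlgebra`.  THEOREMS ONLY (no definition, no instance, no
notation, no named fact, no `sorry`).  Cell `pub/hodgecm-mathlib` (D-0151), FLOOR 0, programme F0P5a (crux item
stmt-HodgeConjecture-24832; PLAN v4.1 ∕ MOD-ROAD-P″ add2 KF8 «duality row», H-CD piece CD2-bc = the BASE-CHANGE half of
«`B ≃ B^DD`, rank, `(S ⊗ B)^D ≅ S ⊗ B^D`»; road- and floor-independent commutative algebra; changes no count).

SETTING.  `R` a commutative ring, `A` an `R`-module (a commutative bialgebra in §3), `S` a commutative `R`-algebra.  Mathlib's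
`Module.Dual.baseChange S : Module.Dual R A →ₗ[R] Module.Dual S (S ⊗[R] A)` is `μ ↦ μ_S`, `μ_S (s ⊗ a) = μ(a) s`
(`Module.Dual.baseChange_apply_tmul`); the tree's ★ `Literature.AlgebraicGeometry.Motives.Tannakian.dualBaseChange S` is the same
map as an `R`-ALGEBRA homomorphism `A^* →ₐ[R] (S ⊗_R A)^*` of Mathlib's convolution algebras `A^* := WithConv (Module.Dual R A)`
(`Tannakian.baseChange_convMul`, `Tannakian.baseChange_counit`).  What this file adds is the statement that, for `A` finite
and free, `μ ↦ μ_S` IS A BASE CHANGE: its `S`-linear extension `S ⊗_R A^* → (S ⊗_R A)^*` is an isomorphism — so the dual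
(convolution) algebra of a finite free bialgebra commutes with base change («`(G^D)_S = (G_S)^D`» on the algebra side) — together
with the rank bookkeeping `rank A^* = rank A` on the `WithConv` carriers.  Everything is Mathlib's `IsBaseChange.dual`
(A. Chambert-Loir) read in the `Module.Dual.baseChange` ∕ `WithConv` currency the H-CD files use.

* §1 **`isBaseChange_dual_baseChange`** — `IsBaseChange S (Module.Dual.baseChange S : A^* → (S ⊗ A)^*)` for `A` finite free;
  consumer forms: `dual_baseChange_equiv_tmul` (the isomorphism `S ⊗_R A^* ≃ (S ⊗_R A)^*` is `s ⊗ μ ↦ s • μ_S`),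
  `span_range_dual_baseChange` (the `μ_S` span `(S ⊗ A)^*` over `S`), `exists_sum_smul_dual_baseChange` (every `S`-linear form on
  `S ⊗_R A` is a finite sum `Σ sᵢ • (μᵢ)_S`), `ext_on_dual_baseChange` (two `S`-linear maps out of `(S ⊗ A)^*` agreeing on the `μ_S`
  are equal), `dual_baseChange_injective`.
* §2 rank bookkeeping (theorems, no instance declared): `free_withConv_dual`, `finite_withConv_dual`, **`finrank_withConv_dual`**
  (`rank_R A^* = rank_R A`), `finrank_dual_baseChange_target` (`rank_S (S ⊗_R A)^* = rank_R A`).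
* §3 (`B` a commutative bialgebra) the same facts for ★ `Tannakian.dualBaseChange S`: `dualBaseChange_ofConv`
  (`(dualBaseChange S μ).ofConv = μ.ofConv_S`), **`span_range_dualBaseChange`**, **`exists_algEquiv_dualBaseChange`** (an `S`-ALGEBRA
  isomorphism `S ⊗_R B^* ≃ₐ[S] (S ⊗_R B)^*` with `s ⊗ μ ↦ s • μ_S`), `dualBaseChange_injective` — i.e. the algebra hom
  `B^* →ₐ[R] (S ⊗ B)^*` becomes an isomorphism after `S ⊗_R –`.

NOT here: the coalgebra ∕ Hopf structure on `A^*` and the bidual `A ≃ A^**` as Hopf algebras (H-CD pieces CD1 ∕ CD2-bidual; they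
need the dual coalgebra), points of the dual (★ `Literature/RingTheory/HopfAlgebra/FiniteDualPoints`).

HC_CM is proved only modulo the 7 printed citations until rung 0 closes; this file is generic algebra and changes no count.

## References
* [Tate1997FiniteFlatGroupSchemes] J. Tate, *Finite flat group schemes*, in: Modular Forms and Fermat's Last Theorem (1997), §(3.8)
  p. 145 (`(A_B)′ = A′_B`).
* [Milne2017] J. S. Milne, *Algebraic Groups*, CUP (2017), Ch. 10 §d 10.19 (`μ ↦ μ_S`).
-/

set_option autoImplicit false

noncomputable section

open TensorProduct WithConv

namespace Literature.RingTheory.HopfAlgebra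

universe u v w

variable {R : Type u} [CommRing R] {A : Type v} [AddCommGroup A] [Module R A]
variable (S : Type w) [CommRing S] [Algebra R S]

/-! ## §1 `μ ↦ μ_S` is a base change for `A` finite free -/

section Linear

/-- On the canonical base change `a ↦ 1 ⊗ a`, Mathlib's `IsBaseChange.toDual` is `Module.Dual.baseChange`.
[cite: Tate1997FiniteFlatGroupSchemes, §(3.8) p. 145] -/
theorem toDual_tensorProduct_isBaseChange (μ : Module.Dual R A) :
    (TensorProduct.isBaseChange R A S).toDual μ = Module.Dual.baseChange S μ := by
  apply LinearMap.ext
  intro x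
  induction x using TensorProduct.induction_on with
  | zero => simp
  | add x y hx hy => simp only [map_add, hx, hy]
  | tmul s a =>
    have hs : s ⊗ₜ[R] a = s • ((TensorProduct.mk R S A 1) a) := by
      simp [TensorProduct.smul_tmul']
    rw [hs, map_smul, map_smul, IsBaseChange.toDual_comp_apply]
    simp [Algebra.smul_def, mul_comm]

/-- **The dual commutes with base change** (Tate: `(A_B)′ = A′_B`): for `A` finite and free over `R` and any commutative
`R`-algebra `S`, the map `μ ↦ μ_S`, `Module.Dual R A → Module.Dual S (S ⊗[R] A)`, is a base change along `R → S`, i.e. its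
`S`-linear extension `S ⊗[R] A^* → (S ⊗[R] A)^*` is an isomorphism. [cite: Tate1997FiniteFlatGroupSchemes, §(3.8) p. 145] -/
theorem isBaseChange_dual_baseChange [Module.Free R A] [Module.Finite R A] :
    IsBaseChange S (Module.Dual.baseChange S : Module.Dual R A →ₗ[R] Module.Dual S (S ⊗[R] A)) := by
  have h := (TensorProduct.isBaseChange R A S).dual
  have e : (TensorProduct.isBaseChange R A S).toDual = Module.Dual.baseChange S :=
    LinearMap.ext (toDual_tensorProduct_isBaseChange S)
  rw [e] at h
  exact h

/-- The isomorphism `S ⊗[R] A^* ≃ (S ⊗[R] A)^*` underlying `isBaseChange_dual_baseChange` is `s ⊗ μ ↦ s • μ_S`.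
[cite: Tate1997FiniteFlatGroupSchemes, §(3.8) p. 145] -/
theorem dual_baseChange_equiv_tmul [Module.Free R A] [Module.Finite R A] (s : S) (μ : Module.Dual R A) :
    (isBaseChange_dual_baseChange S (A := A)).equiv (s ⊗ₜ μ) = s • Module.Dual.baseChange S μ :=
  IsBaseChange.equiv_tmul _ s μ

/-- The forms `μ_S` span `(S ⊗[R] A)^*` over `S` (`A` finite free). [cite: Tate1997FiniteFlatGroupSchemes, §(3.8) p. 145] -/
theorem span_range_dual_baseChange [Module.Free R A] [Module.Finite R A] :
    Submodule.span S (Set.range (Module.Dual.baseChange S : Module.Dual R A →ₗ[R] Module.Dual S (S ⊗[R] A))) = ⊤ := by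
  refine Submodule.eq_top_iff'.mpr fun g => ?_
  obtain ⟨x, rfl⟩ := (isBaseChange_dual_baseChange S (A := A)).equiv.surjective g
  induction x using TensorProduct.induction_on with
  | zero => simp
  | add x y hx hy => simpa only [map_add] using Submodule.add_mem _ hx hy
  | tmul s μ =>
    rw [dual_baseChange_equiv_tmul]
    exact Submodule.smul_mem _ s (Submodule.subset_span ⟨μ, rfl⟩)

/-- Every `S`-linear form on `S ⊗[R] A` (`A` finite free) is a finite sum `Σ sᵢ • (μᵢ)_S` of base-changed `R`-linear forms on
`A`. [cite: Tate1997FiniteFlatGroupSchemes, §(3.8) p. 145] -/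
theorem exists_sum_smul_dual_baseChange [Module.Free R A] [Module.Finite R A] (g : Module.Dual S (S ⊗[R] A)) :
    ∃ (n : ℕ) (s : Fin n → S) (μ : Fin n → Module.Dual R A),
      g = ∑ i, s i • Module.Dual.baseChange S (μ i) := by
  have hg : g ∈ Submodule.span S (Set.range
      (Module.Dual.baseChange S : Module.Dual R A →ₗ[R] Module.Dual S (S ⊗[R] A))) := by
    rw [span_range_dual_baseChange]; exact Submodule.mem_top
  obtain ⟨n, f, c, hsum⟩ := (Submodule.mem_span_set').mp hg
  have hc : ∀ i, ∃ μ : Module.Dual R A, Module.Dual.baseChange S μ = (c i : Module.Dual S (S ⊗[R] A)) :=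
    fun i => (c i).2
  choose μ hμ using hc
  refine ⟨n, f, μ, ?_⟩
  rw [← hsum]
  exact Finset.sum_congr rfl fun i _ => by rw [hμ]

/-- Two `S`-linear maps out of `(S ⊗[R] A)^*` (`A` finite free) that agree on the base-changed forms `μ_S` are equal.
[cite: Tate1997FiniteFlatGroupSchemes, §(3.8) p. 145] -/
theorem ext_on_dual_baseChange [Module.Free R A] [Module.Finite R A] {Q : Type*} [AddCommGroup Q] [Module S Q]
    (g₁ g₂ : Module.Dual S (S ⊗[R] A) →ₗ[S] Q)
    (h : ∀ μ : Module.Dual R A, g₁ (Module.Dual.baseChange S μ) = g₂ (Module.Dual.baseChange S μ)) : g₁ = g₂ :=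
  (isBaseChange_dual_baseChange S (A := A)).algHom_ext g₁ g₂ h

/-- `μ ↦ μ_S` is injective as soon as `R → S` is (no finiteness needed): `μ_S (1 ⊗ a) = μ(a)`.
[cite: Tate1997FiniteFlatGroupSchemes, §(3.8) p. 145] -/
theorem dual_baseChange_injective (hRS : Function.Injective (algebraMap R S)) :
    Function.Injective (Module.Dual.baseChange S : Module.Dual R A →ₗ[R] Module.Dual S (S ⊗[R] A)) := by
  intro μ ν h
  apply LinearMap.ext
  intro a
  have := congrArg (fun g : Module.Dual S (S ⊗[R] A) => g (1 ⊗ₜ a)) h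
  simp only [Module.Dual.baseChange_apply_tmul, Algebra.smul_def, mul_one] at this
  exact hRS this

end Linear

/-! ## §2 Rank bookkeeping on the convolution carriers `WithConv (Module.Dual _ _)` -/

section Rank

/-- `A^* = WithConv (Module.Dual R A)` is free over `R` when `A` is finite free.
[cite: Tate1997FiniteFlatGroupSchemes, §(3.8) p. 144] -/
theorem free_withConv_dual [Module.Free R A] [Module.Finite R A] : Module.Free R (WithConv (Module.Dual R A)) :=
  Module.Free.of_equiv (WithConv.linearEquiv R (Module.Dual R A)).symm

/-- `A^* = WithConv (Module.Dual R A)` is finite over `R` when `A` is finite projective.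
[cite: Tate1997FiniteFlatGroupSchemes, §(3.8) p. 144] -/
theorem finite_withConv_dual [Module.Finite R A] [Module.Projective R A] :
    Module.Finite R (WithConv (Module.Dual R A)) :=
  Module.Finite.equiv (WithConv.linearEquiv R (Module.Dual R A)).symm

/-- `rank_R (Module.Dual R A) = rank_R A` for `A` finite free, over ANY commutative ring (both sides are `1` over the zero
ring). [cite: Tate1997FiniteFlatGroupSchemes, §(3.8) p. 144] -/
theorem finrank_dual_eq [Module.Free R A] [Module.Finite R A] :
    Module.finrank R (Module.Dual R A) = Module.finrank R A := by
  cases subsingleton_or_nontrivial R with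
  | inl h => rw [Module.finrank_subsingleton, Module.finrank_subsingleton]
  | inr h => exact Module.finrank_linearMap_self R R A

/-- **`rank_R A^* = rank_R A`** for `A` finite free (Tate: «`A′` is also finite and locally free [of the same rank]»).
[cite: Tate1997FiniteFlatGroupSchemes, §(3.8) p. 144] -/
theorem finrank_withConv_dual [Module.Free R A] [Module.Finite R A] :
    Module.finrank R (WithConv (Module.Dual R A)) = Module.finrank R A := by
  rw [(WithConv.linearEquiv R (Module.Dual R A)).finrank_eq]
  exact finrank_dual_eq

/-- `rank_S (S ⊗[R] A)^* = rank_R A` for `A` finite free and `S` a non-zero commutative `R`-algebra.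
[cite: Tate1997FiniteFlatGroupSchemes, §(3.8) p. 145] -/
theorem finrank_withConv_dual_baseChange [Nontrivial S] [Module.Free R A] [Module.Finite R A] :
    Module.finrank S (WithConv (Module.Dual S (S ⊗[R] A))) = Module.finrank R A := by
  haveI : Nontrivial R := (algebraMap R S).domain_nontrivial
  rw [finrank_withConv_dual, Module.finrank_baseChange]

end Rank

/-! ## §3 The convolution-algebra map `Tannakian.dualBaseChange S : A^* →ₐ[R] (S ⊗ A)^*` after `S ⊗_R –` -/

section Conv

open Literature.AlgebraicGeometry.Motives

variable {B : Type v} [CommRing B] [Bialgebra R B]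

/-- ★ `Tannakian.dualBaseChange S` is `Module.Dual.baseChange S` on the underlying linear forms.
[cite: Milne2017, Ch. 10 §d 10.19] -/
theorem dualBaseChange_ofConv (μ : WithConv (Module.Dual R B)) :
    (Tannakian.dualBaseChange S μ).ofConv = Module.Dual.baseChange S μ.ofConv :=
  Tannakian.dualBaseChange_apply_ofConv S μ

/-- **The dual convolution algebra commutes with base change**: for a commutative bialgebra `B` finite free over `R`, the images
`μ_S` of the `R`-algebra hom ★ `Tannakian.dualBaseChange S : B^* →ₐ[R] (S ⊗[R] B)^*` span `(S ⊗[R] B)^*` over `S` — with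
`dualBaseChange_injective` ∕ `isBaseChange_dual_baseChange` this says `S ⊗_R B^* → (S ⊗_R B)^*` is an isomorphism of
`S`-algebras (Tate: `(A_B)′ = A′_B`). [cite: Tate1997FiniteFlatGroupSchemes, §(3.8) p. 145] -/
theorem span_range_dualBaseChange [Module.Free R B] [Module.Finite R B] :
    Submodule.span S (Set.range (Tannakian.dualBaseChange (R := R) S (A := B))) = ⊤ := by
  refine Submodule.eq_top_iff'.mpr fun g => ?_
  have hg : g.ofConv ∈ Submodule.span S (Set.range
      (Module.Dual.baseChange S : Module.Dual R B →ₗ[R] Module.Dual S (S ⊗[R] B))) := by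
    rw [span_range_dual_baseChange]; exact Submodule.mem_top
  have hr : ((WithConv.linearEquiv S (Module.Dual S (S ⊗[R] B))).symm :
        Module.Dual S (S ⊗[R] B) →ₗ[S] WithConv (Module.Dual S (S ⊗[R] B))) ''
      Set.range (Module.Dual.baseChange S : Module.Dual R B →ₗ[R] Module.Dual S (S ⊗[R] B)) =
      Set.range (Tannakian.dualBaseChange (R := R) S (A := B)) := by
    ext g'
    constructor
    · rintro ⟨_, ⟨μ, rfl⟩, rfl⟩
      exact ⟨toConv μ, rfl⟩
    · rintro ⟨μ, rfl⟩
      exact ⟨_, ⟨μ.ofConv, rfl⟩, rfl⟩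
  have hmem := Submodule.apply_mem_span_image_of_mem_span
    ((WithConv.linearEquiv S (Module.Dual S (S ⊗[R] B))).symm :
      Module.Dual S (S ⊗[R] B) →ₗ[S] WithConv (Module.Dual S (S ⊗[R] B))) hg
  rwa [hr] at hmem

/-- **`S ⊗_R B^* ≃ (S ⊗_R B)^*` AS `S`-ALGEBRAS** (convolution products on both sides, `S ⊗_R B^*` with Mathlib's
tensor-product algebra structure): for a commutative bialgebra `B` finite free over `R` there is an `S`-algebra isomorphism
`e` with `e (s ⊗ μ) = s • μ_S` — the `S`-linear extension of ★ `Tannakian.dualBaseChange S` (an algebra map by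
`Tannakian.baseChange_convMul`, bijective by `isBaseChange_dual_baseChange`).  Stated as an existence so that no definition is
introduced; `e` is determined by the displayed formula. [cite: Tate1997FiniteFlatGroupSchemes, §(3.8) p. 145] -/
theorem exists_algEquiv_dualBaseChange [Module.Free R B] [Module.Finite R B] :
    ∃ e : S ⊗[R] WithConv (Module.Dual R B) ≃ₐ[S] WithConv (Module.Dual S (S ⊗[R] B)),
      ∀ (s : S) (μ : WithConv (Module.Dual R B)),
        e (s ⊗ₜ μ) = s • Tannakian.dualBaseChange (R := R) S μ := by
  haveI : IsScalarTower R S (WithConv (Module.Dual S (S ⊗[R] B))) := by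
    refine ⟨fun r s f => WithConv.ext (LinearMap.ext fun x => ?_)⟩
    simp only [ofConv_smul, LinearMap.smul_apply, smul_assoc]
  let φ : S ⊗[R] WithConv (Module.Dual R B) →ₐ[S] WithConv (Module.Dual S (S ⊗[R] B)) :=
    Algebra.TensorProduct.lift (Algebra.ofId S _) (Tannakian.dualBaseChange (R := R) S)
      (fun s μ => Algebra.commute_algebraMap_left s _)
  have hφ : ∀ (s : S) (μ : WithConv (Module.Dual R B)),
      φ (s ⊗ₜ μ) = s • Tannakian.dualBaseChange (R := R) S μ := fun s μ => by
    simp only [φ, Algebra.TensorProduct.lift_tmul, Algebra.ofId_apply, Algebra.smul_def]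
  let E : S ⊗[R] WithConv (Module.Dual R B) ≃ₗ[S] WithConv (Module.Dual S (S ⊗[R] B)) :=
    (LinearEquiv.baseChange R S _ _ (WithConv.linearEquiv R (Module.Dual R B))) ≪≫ₗ
      (isBaseChange_dual_baseChange S (A := B)).equiv ≪≫ₗ (WithConv.linearEquiv S (Module.Dual S (S ⊗[R] B))).symm
  have hE : ∀ (s : S) (μ : WithConv (Module.Dual R B)),
      E (s ⊗ₜ μ) = s • Tannakian.dualBaseChange (R := R) S μ := fun s μ => by
    simp only [E, LinearEquiv.trans_apply, LinearEquiv.baseChange_tmul, WithConv.linearEquiv_apply,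
      dual_baseChange_equiv_tmul, map_smul, WithConv.symm_linearEquiv_apply]
    rfl
  have hφE : (φ : S ⊗[R] WithConv (Module.Dual R B) → WithConv (Module.Dual S (S ⊗[R] B))) = E := by
    have h : φ.toLinearMap = E.toLinearMap :=
      TensorProduct.AlgebraTensorModule.ext fun s μ => by
        rw [AlgHom.toLinearMap_apply, LinearEquiv.coe_toLinearMap, hφ, hE]
    funext x
    exact LinearMap.congr_fun h x
  refine ⟨AlgEquiv.ofBijective φ (hφE ▸ E.bijective), fun s μ => ?_⟩
  rw [AlgEquiv.ofBijective_apply]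
  exact hφ s μ

/-- `Tannakian.dualBaseChange S` is injective when `R → S` is. [cite: Tate1997FiniteFlatGroupSchemes, §(3.8) p. 145] -/
theorem dualBaseChange_injective (hRS : Function.Injective (algebraMap R S)) :
    Function.Injective (Tannakian.dualBaseChange (R := R) S (A := B)) := by
  intro μ ν h
  have h' := congrArg WithConv.ofConv h
  rw [dualBaseChange_ofConv, dualBaseChange_ofConv] at h'
  exact WithConv.ofConv_injective (dual_baseChange_injective S hRS h')

end Conv

end Literature.RingTheory.HopfAlgebra
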